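import Summits.AtomisticToContinuum.BoseEinsteinCondensation.Theses.BECStronglyRayleigh
import Summits.AtomisticToContinuum.BoseEinsteinCondensation.Theorems.InsertionFieldDelocalisation.Negative.Toolkit
import Summits.AtomisticToContinuum.BoseEinsteinCondensation.Theorems.InsertionFieldDelocalisation.Negative.PerronExistence
import Summits.AtomisticToContinuum.BoseEinsteinCondensation.Theorems.InsertionFieldDelocalisation.Negative.Tightness
import Summits.AtomisticToContinuum.BoseEinsteinCondensation.Theorems.BECStronglyRayleighGroundStateStabilityEulerGate
import Summits.AtomisticToContinuum.BoseEinsteinCondensation.Theorems.BECStronglyRayleighInsertionFieldDelocalisationExcessBoundRowSum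
import Literature.MathematicalPhysics.QuantumLattice.LiebMattisSectorPF
import Literature.MathematicalPhysics.QuantumLattice.FinDimSpectrumSectorGibbsLimit
import Literature.MathematicalPhysics.QuantumLattice.XYOrderGDProofs
import HarnessLib

/-!
# Occupation-basis bookkeeping for the Penrose–Onsager insertion and removal: helper for stub
# `stub_poExcessBudget` of line `cosh-budget-penrose-onsager`, crux
# `BECStronglyRayleigh.InsertionFieldDelocalisation` (stmt-AtomisticToContinuum-9673)

Supports (does not close) stmt-AtomisticToContinuum-9673. Hard-core bosons on `(ℤ/Lℤ)³` are the
spin-½ XY model `xyTorus 3 L 1` (occupied = index `0` = spin up), the zero-momentum creation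
operator `A† = Σ_x a†_x` is `Ŝ⁺ = Ŝˣ + iŜʸ` and `A = Ŝ⁻`:

* `cb4ex_raise_mulVec_apply_two`, `cb4ex_lower_mulVec_apply_two` : in the occupation basis
  `(Ŝ⁺ψ)(σ) = Σ_{x : σ_x = 0} ψ(σ[x ↦ 1])` (the crux's `poVec`) and `(Ŝ⁻ψ)(σ) = Σ_{x : σ_x = 1} ψ(σ[x ↦ 0])`;
* `cb4ex_card_occ_of_mem` : a sector-`N` vector is supported on configurations with `N` particles;
* `cb4ex_norm_lower_ge` : `‖Ŝ⁻ψ‖² ≥ N ‖ψ‖²` for an entrywise nonnegative sector-`N` vector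
  (drop the cross terms of `⟨ψ, A†A ψ⟩ = Σ_{x,y} ⟨a†_x a_y⟩ ≥ Σ_x ⟨n_x⟩`);
* `cb4ex_zz_lower` : `4 ⟨ψ, Σ_{xy} Sᶻ_xSᶻ_y ψ⟩ ≥ (3L³ - 12N) ‖ψ‖²` on the sector of `N` particles
  (`L ≥ 3`: `3L³` bonds, each particle spoils at most `6` of them, twice);
* `cb4ex_sectorEnergy_zero_le` : `E(0) ≤ 0` (the empty configuration has zero energy);
* `cb4ex_sectorEnergy_mul_norm_le` : the homogeneous variational principle `E(M) ‖φ‖² ≤ ⟨φ, Hφ⟩`;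
* `cb4ex_chemPotential_ge` : convexity of `k ↦ E(k)` gives `m (E(m) - E(m-1)) ≥ E(m) - E(0)`.

All statements are finite-dimensional linear algebra and counting. [folklore]
-/

noncomputable section

namespace Summit.AtomisticToContinuum.BoseEinsteinCondensation.Cruxes.InsertionFieldDelocalisation.CoshBudgetPenroseOnsager

open scoped BigOperators ComplexOrder
open Literature.MathematicalPhysics.QuantumLattice Literature.Probability.LatticeModels Matrix Finset Complex
open Summit.AtomisticToContinuum.BoseEinsteinCondensation.Theorems.InsertionFieldDelocalisation.Negative
open Summit.AtomisticToContinuum.BoseEinsteinCondensation.Cruxes.GroundStateStability.StableConeVariationalSelection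
  (gate_xxzBond_mulVec_apply)
open Summit.AtomisticToContinuum.BoseEinsteinCondensation.Cruxes.InsertionFieldDelocalisation.MobileTrapDirichletEigenfunction
  (mt2ex_re_star_dotProduct_self mt2ex_ne_add_single)

/-! ### The ladder operators in the occupation basis (spin ½) -/

section General

variable {Λ : Type*} [Fintype Λ] [DecidableEq Λ]

/-- **`A† = Ŝ⁺` in the occupation basis** (spin ½, occupied = `0`):
`(Ŝ⁺ψ)(σ) = Σ_{x : σ_x = 0} ψ(σ[x ↦ 1])` — this is the crux's Penrose–Onsager vector `poVec ψ`.
[folklore] -/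
theorem cb4ex_raise_mulVec_apply_two (ψ : TensorIndex Λ 2 → ℂ) (σ : TensorIndex Λ 2) :
    ((totalSpin 1 0 + I • totalSpin 1 1 : Op Λ 2) *ᵥ ψ) σ =
      ∑ x, if σ x = 0 then ψ (Function.update σ x 1) else 0 := by
  rw [LiebMattis.raise_mulVec_apply]
  refine Finset.sum_congr rfl fun x _ => ?_
  rw [LiebMattis.sum_spinRaise_apply_mul]
  have h2 : ∀ a : Fin 2, a = 0 ∨ a = 1 := by decide
  rcases h2 (σ x) with h | h
  · have hlt : (σ x).val + 1 < 1 + 1 := by rw [h]; decide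
    rw [dif_pos hlt, if_pos h]
    have h1 : (⟨(σ x).val + 1, hlt⟩ : Fin 2) = 1 := Fin.ext (by simp [h])
    rw [h1, h]
    simp
  · have hlt : ¬ ((σ x).val + 1 < 1 + 1) := by rw [h]; decide
    rw [dif_neg hlt, if_neg (by rw [h]; decide)]

/-- **`A = Ŝ⁻` in the occupation basis** (spin ½): `(Ŝ⁻ψ)(σ) = Σ_{x : σ_x = 1} ψ(σ[x ↦ 0])`.
[folklore] -/
theorem cb4ex_lower_mulVec_apply_two (ψ : TensorIndex Λ 2 → ℂ) (σ : TensorIndex Λ 2) :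
    ((totalSpin 1 0 - I • totalSpin 1 1 : Op Λ 2) *ᵥ ψ) σ =
      ∑ x, if σ x = 1 then ψ (Function.update σ x 0) else 0 := by
  rw [LiebMattis.totalSpin_lower_eq_sum_onSite, Matrix.sum_mulVec, Finset.sum_apply]
  refine Finset.sum_congr rfl fun x _ => ?_
  rw [LiebMattis.onSite_mulVec_apply, Fin.sum_univ_two, spinLower_apply, spinLower_apply]
  have h2 : ∀ a : Fin 2, a = 0 ∨ a = 1 := by decide
  rcases h2 (σ x) with h | h <;> simp [h]

/-- The entries of `Ŝ⁻ψ` are nonnegative reals if those of `ψ` are. [folklore] -/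
theorem cb4ex_lower_mulVec_nonneg {ψ : TensorIndex Λ 2 → ℂ} (hnn : ∀ σ, 0 ≤ (ψ σ).re ∧ (ψ σ).im = 0)
    (σ : TensorIndex Λ 2) :
    0 ≤ (((totalSpin 1 0 - I • totalSpin 1 1 : Op Λ 2) *ᵥ ψ) σ).re ∧
      (((totalSpin 1 0 - I • totalSpin 1 1 : Op Λ 2) *ᵥ ψ) σ).im = 0 := by
  rw [cb4ex_lower_mulVec_apply_two, Complex.re_sum, Complex.im_sum]
  refine ⟨Finset.sum_nonneg fun x _ => ?_, Finset.sum_eq_zero fun x _ => ?_⟩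
  · split_ifs
    · exact (hnn _).1
    · simp
  · split_ifs
    · exact (hnn _).2
    · simp

/-- **A sector-`N` vector lives on `N`-particle configurations**: if `ψ ∈ 𝓗_{N - |Λ|/2}` and
`ψ(σ) ≠ 0` then `#{x | σ_x = 0} = N`. [folklore] -/
theorem cb4ex_card_occ_of_mem {N : ℕ} {ψ : TensorIndex Λ 2 → ℂ}
    (hsec : ψ ∈ spinZSector 1 ((N : ℝ) - (Fintype.card Λ : ℝ) / 2)) {σ : TensorIndex Λ 2}
    (hσ : ψ σ ≠ 0) : (Finset.univ.filter fun z => σ z = 0).card = N := by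
  -- adapted from `mt2ex_E_lower` (Theorems/…ExcessBoundRowSum.lean)
  have hmag := (LiebMattis.mem_spinZSector_iff 1 _ ψ).mp hsec σ hσ
  rw [← ind_filter_eq σ, magnetisation_ind] at hmag
  push_cast at hmag
  have h : ((Finset.univ.filter fun z => σ z = 0).card : ℂ) = (N : ℂ) := by
    linear_combination hmag
  exact_mod_cast h

/-- `Re ⟨v, v⟩ = Σ_σ (Re v_σ)²` for an entrywise real vector. [folklore] -/
theorem cb4ex_re_norm_of_real {ι : Type*} [Fintype ι] {v : ι → ℂ} (hv : ∀ i, (v i).im = 0) :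
    (star v ⬝ᵥ v).re = ∑ i, (v i).re ^ 2 := by
  rw [dotProduct, Complex.re_sum]
  refine Finset.sum_congr rfl fun i _ => ?_
  rw [Pi.star_apply, Complex.mul_re, Complex.star_def, Complex.conj_re, Complex.conj_im, hv i]
  ring

/-- **`‖Aψ‖² ≥ N ‖ψ‖²` for an entrywise nonnegative sector-`N` vector**: the removal amplitude
`(Ŝ⁻ψ)(σ) = Σ_{x : σ_x = 1} ψ(σ[x ↦ 0])` is a sum of nonnegative terms, so its square dominates the
sum of squares, and each `N`-particle configuration is reached from exactly `N` configurations.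
[folklore] -/
theorem cb4ex_norm_lower_ge {N : ℕ} {ψ : TensorIndex Λ 2 → ℂ}
    (hsec : ψ ∈ spinZSector 1 ((N : ℝ) - (Fintype.card Λ : ℝ) / 2))
    (hnn : ∀ σ, 0 ≤ (ψ σ).re ∧ (ψ σ).im = 0) :
    (N : ℝ) * (star ψ ⬝ᵥ ψ).re ≤
      (star ((totalSpin 1 0 - I • totalSpin 1 1 : Op Λ 2) *ᵥ ψ) ⬝ᵥ
        ((totalSpin 1 0 - I • totalSpin 1 1 : Op Λ 2) *ᵥ ψ)).re := by
  set f : TensorIndex Λ 2 → ℝ := fun τ => (ψ τ).re ^ 2 with hf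
  rw [cb4ex_re_norm_of_real fun σ => (cb4ex_lower_mulVec_nonneg hnn σ).2,
    cb4ex_re_norm_of_real fun σ => (hnn σ).2]
  -- Step 1: square of a nonnegative sum dominates the sum of squares
  have hsq : ∀ σ : TensorIndex Λ 2,
      ∑ x, (if σ x = 1 then f (Function.update σ x 0) else 0) ≤
        (((totalSpin 1 0 - I • totalSpin 1 1 : Op Λ 2) *ᵥ ψ) σ).re ^ 2 := by
    intro σ
    rw [cb4ex_lower_mulVec_apply_two, Complex.re_sum]
    have hterm : ∀ x : Λ, ((if σ x = 1 then ψ (Function.update σ x 0) else 0 : ℂ)).re =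
        if σ x = 1 then (ψ (Function.update σ x 0)).re else 0 := by
      intro x; split_ifs <;> simp
    simp only [hterm]
    have hnn' : ∀ x ∈ (Finset.univ : Finset Λ),
        0 ≤ (if σ x = 1 then (ψ (Function.update σ x 0)).re else 0) := by
      intro x _; split_ifs
      · exact (hnn _).1
      · exact le_rfl
    calc ∑ x, (if σ x = 1 then f (Function.update σ x 0) else 0)
        = ∑ x, (if σ x = 1 then (ψ (Function.update σ x 0)).re else 0) ^ 2 := by
          refine Finset.sum_congr rfl fun x _ => ?_
          split_ifs <;> simp [hf]
      _ ≤ (∑ x, (if σ x = 1 then (ψ (Function.update σ x 0)).re else 0)) ^ 2 :=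
          Finset.sum_sq_le_sq_sum_of_nonneg hnn'
  -- Step 2: reindex `σ ↦ σ[x ↦ 0]` on `{σ_x = 1}` (flip the site `x`)
  have hflip : ∀ x : Λ, ∑ σ : TensorIndex Λ 2, (if σ x = 1 then f (Function.update σ x 0) else 0) =
      ∑ τ : TensorIndex Λ 2, (if τ x = 0 then f τ else 0) := by
    intro x
    have hinv : Function.Involutive (fun σ : TensorIndex Λ 2 => Function.update σ x (Equiv.swap 0 1 (σ x))) := by
      intro σ
      simp only [Function.update_self, Equiv.swap_apply_self, Function.update_idem, Function.update_eq_self]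
    refine Fintype.sum_equiv (hinv.toPerm _) _ _ fun σ => ?_
    simp only [Function.Involutive.coe_toPerm, Function.update_self]
    have h2 : ∀ a : Fin 2, a = 0 ∨ a = 1 := by decide
    rcases h2 (σ x) with h | h
    · simp [h]
    · simp [h, Equiv.swap_apply_right]
  -- Step 3: count
  have hocc : ∀ τ : TensorIndex Λ 2, ∑ x, (if τ x = 0 then f τ else 0) = N * f τ := by
    intro τ
    by_cases hτ : ψ τ = 0
    · simp [hf, hτ]
    · rw [← Finset.sum_filter, Finset.sum_const, nsmul_eq_mul, cb4ex_card_occ_of_mem hsec hτ]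
  calc (N : ℝ) * ∑ τ, (ψ τ).re ^ 2 = ∑ τ, ∑ x, (if τ x = 0 then f τ else 0) := by
        rw [Finset.mul_sum]; exact Finset.sum_congr rfl fun τ _ => (hocc τ).symm
    _ = ∑ x, ∑ σ : TensorIndex Λ 2, (if σ x = 1 then f (Function.update σ x 0) else 0) := by
        rw [Finset.sum_comm]; exact Finset.sum_congr rfl fun x _ => (hflip x).symm
    _ = ∑ σ : TensorIndex Λ 2, ∑ x, (if σ x = 1 then f (Function.update σ x 0) else 0) :=
        Finset.sum_comm
    _ ≤ ∑ σ, (((totalSpin 1 0 - I • totalSpin 1 1 : Op Λ 2) *ᵥ ψ) σ).re ^ 2 :=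
        Finset.sum_le_sum fun σ _ => hsq σ

/-- **The `SᶻSᶻ` bond is diagonal in the occupation basis**: for `x ≠ y`,
`(Sᶻ_xSᶻ_y φ)(σ) = ± ¼ φ(σ)` according as `σ_x = σ_y` or not. [folklore] -/
theorem cb4ex_zzBond_mulVec_apply {x y : Λ} (hxy : x ≠ y) (φ : TensorIndex Λ 2 → ℂ)
    (σ : TensorIndex Λ 2) :
    ((spinBond 1 2 x y : Op Λ 2) *ᵥ φ) σ = (if σ x = σ y then (1 / 4 : ℂ) else -(1 / 4 : ℂ)) * φ σ := by
  have h1 := gate_xxzBond_mulVec_apply hxy 1 φ σ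
  have h0 := gate_xxzBond_mulVec_apply hxy 0 φ σ
  have hB : (spinBond 1 2 x y : Op Λ 2) =
      (spinBond 1 0 x y + spinBond 1 1 x y + (1 : ℂ) • spinBond 1 2 x y) -
        (spinBond 1 0 x y + spinBond 1 1 x y + (0 : ℂ) • spinBond 1 2 x y) := by
    rw [one_smul, zero_smul, add_zero, add_sub_cancel_left]
  rw [hB, sub_mulVec, Pi.sub_apply, h1, h0]
  ring

/-- `Re ⟨φ, Sᶻ_xSᶻ_y φ⟩ = Σ_σ (±¼) |φ(σ)|²`. [folklore] -/
theorem cb4ex_re_zzBond_form {x y : Λ} (hxy : x ≠ y) (φ : TensorIndex Λ 2 → ℂ) :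
    (star φ ⬝ᵥ (spinBond 1 2 x y : Op Λ 2) *ᵥ φ).re =
      ∑ σ, (if σ x = σ y then (1 / 4 : ℝ) else -(1 / 4 : ℝ)) * ‖φ σ‖ ^ 2 := by
  rw [dotProduct, Complex.re_sum]
  refine Finset.sum_congr rfl fun σ _ => ?_
  rw [Pi.star_apply, cb4ex_zzBond_mulVec_apply hxy, mul_left_comm, Complex.star_def,
    Complex.conj_mul', ← Complex.ofReal_pow]
  split_ifs
  · rw [show (1 / 4 : ℂ) = ((1 / 4 : ℝ) : ℂ) by push_cast; ring, ← Complex.ofReal_mul, Complex.ofReal_re]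
  · rw [show -(1 / 4 : ℂ) = ((-(1 / 4) : ℝ) : ℂ) by push_cast; ring, ← Complex.ofReal_mul,
      Complex.ofReal_re]

/-- **The homogeneous variational principle in a sector**: `E(M) · ‖φ‖² ≤ Re ⟨φ, Hφ⟩` for every
`φ` in the magnetisation sector `M` of the XY model `xxzHamiltonian 1 G J 0`. [folklore] -/
theorem cb4ex_sectorEnergy_mul_norm_le (G : SimpleGraph Λ) [DecidableRel G.Adj] (J : ℝ) (M : ℝ)
    {φ : TensorIndex Λ 2 → ℂ} (hφ : φ ∈ spinZSector 1 M) :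
    lowestEnergyInSector 1 (xxzHamiltonian 1 G J 0) M * (star φ ⬝ᵥ φ).re ≤
      (star φ ⬝ᵥ xxzHamiltonian 1 G J 0 *ᵥ φ).re :=
  LiebMattis.mul_norm_le_of_unit_bound 1 (xxzHamiltonian 1 G J 0) (spinZSector 1 M)
    (fun _ hv hv1 => minEnergyOn_le_rayleigh_of_mem (xxzZero_isHermitian G J) _ hv hv1) hφ

/-- **`E(0) ≤ 0`**: the sector energy of the empty sector (all spins down, `M = -|Λ|/2`) of the XY
model is at most the energy `0` of the empty configuration (zero diagonal). [folklore] -/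
theorem cb4ex_sectorEnergy_zero_le (G : SimpleGraph Λ) [DecidableRel G.Adj] (J : ℝ) (M₀ : ℝ)
    (hM₀ : M₀ = ((0 : ℕ) : ℝ) - (Fintype.card Λ : ℝ) / 2) :
    lowestEnergyInSector 1 (xxzHamiltonian 1 G J 0) M₀ ≤ 0 := by
  have hmem : bvec (fun z => if z ∈ (∅ : Finset Λ) then (0 : Fin 2) else 1) ∈ spinZSector 1 M₀ :=
    bvec_ind_mem_spinZSector ∅ M₀ (by rw [hM₀, Finset.card_empty])
  have h1 : star (bvec (fun z => if z ∈ (∅ : Finset Λ) then (0 : Fin 2) else 1)) ⬝ᵥ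
      bvec (fun z => if z ∈ (∅ : Finset Λ) then (0 : Fin 2) else 1) = 1 := by
    simp [dotProduct, bvec_apply, Finset.sum_ite_eq']
  have h := minEnergyOn_le_rayleigh_of_mem (xxzZero_isHermitian G J) _ hmem h1
  rw [mulVec_bvec] at h
  refine h.trans (le_of_eq ?_)
  rw [dotProduct, Finset.sum_eq_single (fun z => if z ∈ (∅ : Finset Λ) then (0 : Fin 2) else 1)]
  · rw [Pi.star_apply, xxzZero_apply, if_pos rfl, mul_zero, Complex.zero_re]
  · intro σ _ hσ
    rw [Pi.star_apply, bvec_apply, if_neg hσ, star_zero, zero_mul]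
  · intro h'
    exact absurd (Finset.mem_univ _) h'

end General

/-! ### Convexity arithmetic -/

/-- **Monotone chemical potential**: if `k ↦ E(k)` is convex on `1 ≤ k`, `k + 1 ≤ V`, then
`m (E(m) - E(m-1)) ≥ E(m) - E(0)` for `1 ≤ m ≤ V`. [folklore] -/
theorem cb4ex_chemPotential_ge (E : ℕ → ℝ) (V : ℕ)
    (hconv : ∀ k : ℕ, 1 ≤ k → k + 1 ≤ V → 2 * E k ≤ E (k + 1) + E (k - 1)) :
    ∀ m : ℕ, 1 ≤ m → m ≤ V → E m - E 0 ≤ m * (E m - E (m - 1)) := by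
  intro m hm hmV
  induction m with
  | zero => omega
  | succ m ih =>
    rcases Nat.eq_zero_or_pos m with h0 | hpos
    · subst h0
      simp
    · have ih' := ih hpos (by omega)
      have hc := hconv m hpos hmV
      have hm1 : m - 1 + 1 = m := by omega
      rw [Nat.add_sub_cancel]
      push_cast
      nlinarith [ih', hc]

/-! ### The XY torus: the `SᶻSᶻ` energy on the `N`-particle sector -/

section Torus

/-- **Lower bound for the Ising energy of a configuration on `(ℤ/Lℤ)³`**:
`Σ_x Σ_i s_x s_{x+eᵢ} ≥ 3L³ - 12 #{x | σ_x = 0}` with `s = ±1` (`3L³` site–direction pairs; a pair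
with `s_x s_{x+eᵢ} = -1` has an occupied endpoint, and each site lies on `6` pairs). [folklore] -/
theorem cb4ex_ising_lower (L : ℕ) [NeZero L] (σ : TensorIndex (TorusSite 3 L) 2) :
    3 * (L : ℝ) ^ 3 - 12 * ((Finset.univ.filter fun z => σ z = 0).card : ℝ) ≤
      ∑ x : TorusSite 3 L, ∑ i : Fin 3, (if σ x = σ (x + Pi.single i 1) then (1 : ℝ) else -1) := by
  have hle : ∀ (x : TorusSite 3 L) (i : Fin 3),
      1 - 2 * (if σ x = 0 then (1 : ℝ) else 0) - 2 * (if σ (x + Pi.single i 1) = 0 then (1 : ℝ) else 0) ≤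
        (if σ x = σ (x + Pi.single i 1) then (1 : ℝ) else -1) := by
    intro x i
    have h2 : ∀ a : Fin 2, a = 0 ∨ a = 1 := by decide
    rcases h2 (σ x) with h | h <;> rcases h2 (σ (x + Pi.single i 1)) with h' | h' <;>
      simp [h, h'] <;> norm_num
  have hcount : ∀ i : Fin 3,
      ∑ x : TorusSite 3 L, (if σ (x + Pi.single i 1) = 0 then (1 : ℝ) else 0) =
        ∑ x : TorusSite 3 L, (if σ x = 0 then (1 : ℝ) else 0) := fun i =>
    -- adapted from `mt2ex_pairs_indicator_le` (Theorems/…ExcessBoundRowSum.lean)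
    Fintype.sum_equiv (Equiv.addRight (Pi.single i 1)) _ _ fun x => rfl
  have hN : ∑ x : TorusSite 3 L, (if σ x = 0 then (1 : ℝ) else 0) =
      ((Finset.univ.filter fun z => σ z = 0).card : ℝ) := by
    rw [Finset.sum_boole]
  calc 3 * (L : ℝ) ^ 3 - 12 * ((Finset.univ.filter fun z => σ z = 0).card : ℝ)
      = ∑ x : TorusSite 3 L, ∑ i : Fin 3, (1 - 2 * (if σ x = 0 then (1 : ℝ) else 0) -
          2 * (if σ (x + Pi.single i 1) = 0 then (1 : ℝ) else 0)) := by
        rw [Finset.sum_comm]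
        simp only [Finset.sum_sub_distrib, ← Finset.mul_sum, hcount, hN, Finset.sum_const,
          Finset.card_univ, Fintype.card_fin, card_torusSite, nsmul_eq_mul]
        push_cast
        ring
    _ ≤ ∑ x : TorusSite 3 L, ∑ i : Fin 3, (if σ x = σ (x + Pi.single i 1) then (1 : ℝ) else -1) :=
        Finset.sum_le_sum fun x _ => Finset.sum_le_sum fun i _ => hle x i

/-- **The `SᶻSᶻ` energy on the `N`-particle sector**: for `L ≥ 3` and `ψ` in the sector of `N`
hard-core bosons, `4 Re ⟨ψ, Σ_{xy ∈ E} Sᶻ_xSᶻ_y ψ⟩ ≥ (3L³ - 12N) ‖ψ‖²`. [folklore] -/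
theorem cb4ex_zz_lower (L : ℕ) [NeZero L] (hL : 3 ≤ L) (N : ℕ) (ψ : TensorIndex (TorusSite 3 L) 2 → ℂ)
    (hsec : ψ ∈ spinZSector 1 ((N : ℝ) - (L : ℝ) ^ 3 / 2)) :
    (3 * (L : ℝ) ^ 3 - 12 * N) * (star ψ ⬝ᵥ ψ).re ≤
      4 * (star ψ ⬝ᵥ (∑ e ∈ (torusGraph 3 L).edgeFinset,
        Sym2.lift ⟨fun x y => spinBond 1 2 x y, fun x y => spinBond_comm 1 2 y x⟩ e) *ᵥ ψ).re := by
  have hsec' : ψ ∈ spinZSector 1 ((N : ℝ) - (Fintype.card (TorusSite 3 L) : ℝ) / 2) := by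
    rw [card_torusSite]; push_cast; exact hsec
  -- edges versus site–direction pairs (`L ≥ 3`)
  have hZ : (∑ e ∈ (torusGraph 3 L).edgeFinset,
      Sym2.lift ⟨fun x y => spinBond 1 2 x y, fun x y => spinBond_comm 1 2 y x⟩ e : Op (TorusSite 3 L) 2) =
      ∑ x : TorusSite 3 L, ∑ i : Fin 3, spinBond 1 2 x (x + Pi.single i 1) := by
    have h := sum_pairs_eq_sum_edgeFinset' (d := 3) L hL
      (fun e => Sym2.lift ⟨fun x y => spinBond 1 2 x y, fun x y => spinBond_comm 1 2 y x⟩ e)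
    simp only [Sym2.lift_mk] at h
    exact h.symm
  -- the form, configuration by configuration
  have hform : (star ψ ⬝ᵥ (∑ x : TorusSite 3 L, ∑ i : Fin 3, spinBond 1 2 x (x + Pi.single i 1)) *ᵥ ψ).re =
      ∑ σ, (∑ x : TorusSite 3 L, ∑ i : Fin 3,
        (if σ x = σ (x + Pi.single i 1) then (1 / 4 : ℝ) else -(1 / 4 : ℝ))) * ‖ψ σ‖ ^ 2 := by
    have h1 : ∀ x : TorusSite 3 L,
        (star ψ ⬝ᵥ (∑ i : Fin 3, spinBond 1 2 x (x + Pi.single i 1)) *ᵥ ψ).re =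
          ∑ σ, (∑ i : Fin 3, (if σ x = σ (x + Pi.single i 1) then (1 / 4 : ℝ) else -(1 / 4 : ℝ))) *
            ‖ψ σ‖ ^ 2 := by
      intro x
      rw [Matrix.sum_mulVec, dotProduct_sum, Complex.re_sum,
        Finset.sum_congr rfl fun i _ => cb4ex_re_zzBond_form (mt2ex_ne_add_single L (by omega) x i) ψ,
        Finset.sum_comm]
      refine Finset.sum_congr rfl fun σ _ => ?_
      rw [Finset.sum_mul]
    rw [Matrix.sum_mulVec, dotProduct_sum, Complex.re_sum, Finset.sum_congr rfl fun x _ => h1 x,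
      Finset.sum_comm]
    refine Finset.sum_congr rfl fun σ _ => ?_
    rw [Finset.sum_mul]
  rw [hZ, hform, mt2ex_re_star_dotProduct_self ψ, Finset.mul_sum, Finset.mul_sum]
  refine Finset.sum_le_sum fun σ _ => ?_
  by_cases hσ : ψ σ = 0
  · simp [hσ]
  · have hI := cb4ex_ising_lower L σ
    rw [cb4ex_card_occ_of_mem hsec' hσ] at hI
    have h4 : 4 * (∑ x : TorusSite 3 L, ∑ i : Fin 3,
        (if σ x = σ (x + Pi.single i 1) then (1 / 4 : ℝ) else -(1 / 4 : ℝ))) =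
        ∑ x : TorusSite 3 L, ∑ i : Fin 3, (if σ x = σ (x + Pi.single i 1) then (1 : ℝ) else -1) := by
      rw [Finset.mul_sum]
      refine Finset.sum_congr rfl fun x _ => ?_
      rw [Finset.mul_sum]
      refine Finset.sum_congr rfl fun i _ => ?_
      split_ifs <;> norm_num
    have hpos : 0 ≤ ‖ψ σ‖ ^ 2 := sq_nonneg _
    calc (3 * (L : ℝ) ^ 3 - 12 * N) * ‖ψ σ‖ ^ 2
        ≤ (∑ x : TorusSite 3 L, ∑ i : Fin 3, (if σ x = σ (x + Pi.single i 1) then (1 : ℝ) else -1)) *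
            ‖ψ σ‖ ^ 2 := mul_le_mul_of_nonneg_right hI hpos
      _ = 4 * ((∑ x : TorusSite 3 L, ∑ i : Fin 3,
            (if σ x = σ (x + Pi.single i 1) then (1 / 4 : ℝ) else -(1 / 4 : ℝ))) * ‖ψ σ‖ ^ 2) := by
          rw [← h4]; ring

/-! ### Registered sub-goal: `‖Aψ‖² ≥ N‖ψ‖²` -/

/-- **Registered sub-goal `stub_poExcessBudgetRemovalNorm`** (helper of `stub_poExcessBudget`, line
`cosh-budget-penrose-onsager`): for an entrywise nonnegative vector in the sector of `N` hard-core
bosons on `(ℤ/Lℤ)³`, the Penrose–Onsager removal `(Aψ)(σ) = Σ_{x : σ_x = 1} ψ(σ[x ↦ 0])` has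
`‖Aψ‖² ≥ N ‖ψ‖²` (`⟨ψ, A†Aψ⟩ = L³⟨a₀†a₀⟩ ≥ Σ_x ⟨n_x⟩`). [folklore] -/
theorem stub_poExcessBudgetRemovalNorm :
    ∀ (L : ℕ) [NeZero L] (N : ℕ) (ψ : TensorIndex (TorusSite 3 L) 2 → ℂ), ψ ∈ spinZSector 1 ((N : ℝ)
      - (L : ℝ) ^ 3 / 2) → (∀ σ, 0 ≤ (ψ σ).re ∧ (ψ σ).im = 0) → (N : ℝ) * (star ψ ⬝ᵥ ψ).re ≤ (star
      ((fun σ => ∑ x, if σ x = 1 then ψ (Function.update σ x 0) else 0)) ⬝ᵥ ((fun σ => ∑ x, if σ x = 1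
      then ψ (Function.update σ x 0) else 0))).re := by
  intro L _ N ψ hsec hnn
  have hrm : (fun σ => ∑ x, if σ x = 1 then ψ (Function.update σ x 0) else 0) =
      (totalSpin 1 0 - I • totalSpin 1 1 : Op (TorusSite 3 L) 2) *ᵥ ψ :=
    funext fun σ => (cb4ex_lower_mulVec_apply_two ψ σ).symm
  have hsec' : ψ ∈ spinZSector 1 ((N : ℝ) - (Fintype.card (TorusSite 3 L) : ℝ) / 2) := by
    rw [card_torusSite]; push_cast; exact hsec
  rw [hrm]
  exact cb4ex_norm_lower_ge hsec' hnn

end Torus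

end Summit.AtomisticToContinuum.BoseEinsteinCondensation.Cruxes.InsertionFieldDelocalisation.CoshBudgetPenroseOnsager

end
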